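import Mathlib
import Literature.Combinatorics.SimpleGraph.BoxProdSpanningTrees
import Literature.Combinatorics.SimpleGraph.AlgebraicConnectivityJoin
import Literature.Combinatorics.SimpleGraph.DisconnectedVertexSets
import HarnessLib

/-!
# Fiedler's product theorem: `a(G₁ × G₂) = min(a(G₁), a(G₂))` for the Cartesian product

Source (held, read at the page; VERBATIM). M. Fiedler, *Algebraic connectivity of graphs*,
Czechoslovak Math. J. 23 (98) (1973) 298–305 [Fiedler1973] (held text
`paper:doi-10-21136-cmj-1973-101168`, p0004 = p. 300). «**3.4.** We have
`a(G₁ × G₂) = min(a(G₁), a(G₂))`. Proof. Let `G₁ = (V₁, E₁)`, `G₂ = (V₂, E₂)`. Order the set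
`V₁ × V₂` lexicographically. Then `A(G₁ × G₂) = A(G₁) × I₂ + I₁ × A(G₂)`, `I_j` being the
`|V_j|`-rowed identity matrix. By a well known result from the matrix theory [1] all eigenvalues
of `A(G₁ × G₂)` are of the form `μ + ν` where `μ`, `ν` resp. are eigenvalues of `A(G₁)`, `A(G₂)`
respectively. Hence the second smallest eigenvalue of `A(G₁ × G₂)` is either `a(G₁) + 0` or
`0 + a(G₂)`.» (Here `A(G)` is Fiedler's notation for the Laplacian, p. 298: «off-diagonal entries
… `−1` if `(w_i, w_k) ∈ E` … diagonal entries `a_ii` are equal to the valencies», and `a(G)` is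
its second smallest eigenvalue.) Also J. J. Molitierno, *Applications of Combinatorial Matrix
Theory to Laplacian Matrices of Graphs* (CRC Press 2012) [Molitierno2012], §5.1 Exercise 2
(p0154): «(See [28]) Prove `a(𝒢₁ × 𝒢₂) = min{a(𝒢₁), a(𝒢₂)}`.» and §4.1 Theorem 4.1.9 (p0105):
«the eigenvalues of `L(𝒢 × ℋ)` are `{α_i + β_j | α_i ∈ A, β_j ∈ B}`».

## What is formalised (tree vocabulary) and the route

`G₁ × G₂` is Mathlib's Cartesian product `G □ H` on `V × W`; «all eigenvalues of `A(G₁ × G₂)`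
are of the form `μ + ν`» with multiplicity is the tree's
`BoxProdSpanningTrees.charpoly_lapMatrix_boxProd` (`χ(L(G □ H)) = ∏_{(i,j)} (X − (λ_i + μ_j))`);
`a(G)` is `hL.eigenvalues₀ ⟨|V| − 2, _⟩` of `G.lapMatrix ℝ` (the tree's `AlgebraicConnectivity`).
THEOREMS ONLY (no definition, no named fact).

* §1 the second-smallest Laplace eigenvalue as the least element of the spectrum with one `0`
  removed (`algConn_isLeast_erase`, from the tree's `AlgebraicConnectivityJoin.add_algConn_isLeast`),
  and the Laplace spectrum of `G □ H` as the multiset of sums (`map_eigenvalues_lapMatrix_boxProd`).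
* §2 **`algConn_boxProd_le_left`**, **`algConn_boxProd_le_right`** (`a(G □ H) ≤ a(G), a(H)`:
  the spectrum of `G` sits inside that of `G □ H` as `{λ_i + 0}`), **`Fiedler1973_3_4`** =
  `algConn_boxProd` (`a(G □ H) = min(a(G), a(H))`, Fiedler's «either `a(G₁) + 0` or `0 + a(G₂)`»;
  the case where the second-smallest sum is `0 + 0` is the disconnected case, read through
  Mathlib's `SimpleGraph.connected_boxProd`), for `|V|, |W| ≥ 2`.

## References
* M. Fiedler, Algebraic connectivity of graphs, Czechoslovak Math. J. 23 (1973) 298–305, §3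
  item 3.4 (p. 300) [Fiedler1973].
* J. J. Molitierno, *Applications of Combinatorial Matrix Theory to Laplacian Matrices of Graphs*,
  CRC Press 2012, §4.1 Thm. 4.1.9 (p0105), §5.1 Exercise 2 (p0154) [Molitierno2012].
* through the imports: `BoxProdSpanningTrees` (B–H §1.4.6, `χ(L(G □ H))`),
  `AlgebraicConnectivityJoin` (`add_algConn_isLeast`), `DisconnectedVertexSets`
  (`exists_lapMatrix_eigenvalues_eq_zero`), `AlgebraicConnectivity` (B–H §1.7).
-/

namespace Literature.Combinatorics.SimpleGraph.AlgebraicConnectivityCartesianProduct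

open Finset Matrix Polynomial
open BoxProdSpanningTrees (charpoly_lapMatrix_boxProd)
open AlgebraicConnectivityJoin (add_algConn_isLeast)
open DisconnectedVertexSets (exists_lapMatrix_eigenvalues_eq_zero)
open AlgebraicConnectivity (algConn_nonneg algConn_eq_zero_of_not_connected
  algConn_pos_iff_connected)

variable {V W : Type*} [Fintype V] [DecidableEq V] [Fintype W] [DecidableEq W]
  (G : SimpleGraph V) (H : SimpleGraph W) [DecidableRel G.Adj] [DecidableRel H.Adj]

/-! ## §1 `a(G)` inside the spectrum, and the spectrum of `G □ H` -/

/-- **`a(G)` is the least Laplace eigenvalue once ONE zero is removed from the spectrum**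
(`λ₁ = 0 ≤ λ₂ = a(G) ≤ ⋯`). [cite: Fiedler1973, §1 (p. 298: «`0 = λ₁ ≤ λ₂ = a(G) ≤ λ₃ ≤ … ≤ λ_n`
… the second smallest eigenvalue `a(G)`»)] -/
theorem algConn_isLeast_erase (ht : 2 ≤ Fintype.card V) (hG : (G.lapMatrix ℝ).IsHermitian) :
    hG.eigenvalues₀ ⟨Fintype.card V - 2, by omega⟩ ∈
        ((univ : Finset V).val.map hG.eigenvalues).erase 0 ∧
      ∀ x ∈ ((univ : Finset V).val.map hG.eigenvalues).erase 0,
        hG.eigenvalues₀ ⟨Fintype.card V - 2, by omega⟩ ≤ x := by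
  have h := add_algConn_isLeast G ht hG 0
  simp only [zero_add] at h
  exact h

/-- **The Laplace spectrum of `G □ H` is the multiset of all sums `λ_i + μ_j`** (Fiedler: «all
eigenvalues of `A(G₁ × G₂)` are of the form `μ + ν`»; Molitierno Thm. 4.1.9), read off the tree's
`charpoly_lapMatrix_boxProd`. [cite: Fiedler1973, §3 item 3.4 proof (p. 300)]
[cite: Molitierno2012, §4.1 Thm. 4.1.9, p0105] -/
theorem map_eigenvalues_lapMatrix_boxProd [DecidableRel (G □ H).Adj]
    (hG : (G.lapMatrix ℝ).IsHermitian) (hH : (H.lapMatrix ℝ).IsHermitian)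
    (hP : ((G □ H).lapMatrix ℝ).IsHermitian) :
    (univ : Finset (V × W)).val.map hP.eigenvalues =
      (univ : Finset (V × W)).val.map (fun p => hG.eigenvalues p.1 + hH.eigenvalues p.2) := by
  have hr := hP.roots_charpoly_eq_eigenvalues
  rw [charpoly_lapMatrix_boxProd G H hG hH, Polynomial.roots_prod _ _
    (Polynomial.monic_prod_of_monic _ _ fun p _ => Polynomial.monic_X_sub_C _).ne_zero] at hr
  simp_rw [Polynomial.roots_X_sub_C, Multiset.bind_singleton] at hr
  simp only [Function.comp_def, RCLike.ofReal_real_eq_id, id_eq] at hr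
  exact hr.symm

/-- The spectrum of `G` sits inside that of `G □ H` as `{λ_i + μ_{j₀}}` for a zero eigenvalue
`μ_{j₀} = 0` of `H`. [cite: Fiedler1973, §3 item 3.4 proof (p. 300)] -/
theorem map_eigenvalues_le_boxProd_left [DecidableRel (G □ H).Adj] [Nonempty W]
    (hG : (G.lapMatrix ℝ).IsHermitian) (hH : (H.lapMatrix ℝ).IsHermitian)
    (hP : ((G □ H).lapMatrix ℝ).IsHermitian) :
    (univ : Finset V).val.map hG.eigenvalues ≤ (univ : Finset (V × W)).val.map hP.eigenvalues := by
  obtain ⟨j₀, hj₀⟩ := exists_lapMatrix_eigenvalues_eq_zero H hH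
  rw [map_eigenvalues_lapMatrix_boxProd G H hG hH hP]
  have hemb : (univ : Finset V).val.map hG.eigenvalues =
      ((univ : Finset V).map ⟨fun i => (i, j₀), fun a b h => by simpa using congrArg Prod.fst h⟩).val.map
        (fun p : V × W => hG.eigenvalues p.1 + hH.eigenvalues p.2) := by
    rw [Finset.map_val, Multiset.map_map]
    refine Multiset.map_congr rfl fun i _ => ?_
    simp [hj₀]
  rw [hemb]
  exact Multiset.map_le_map (Finset.val_le_iff.2 (Finset.subset_univ _))

/-- The spectrum of `H` sits inside that of `G □ H` as `{λ_{i₀} + μ_j}` for a zero eigenvalue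
`λ_{i₀} = 0` of `G`. [cite: Fiedler1973, §3 item 3.4 proof (p. 300)] -/
theorem map_eigenvalues_le_boxProd_right [DecidableRel (G □ H).Adj] [Nonempty V]
    (hG : (G.lapMatrix ℝ).IsHermitian) (hH : (H.lapMatrix ℝ).IsHermitian)
    (hP : ((G □ H).lapMatrix ℝ).IsHermitian) :
    (univ : Finset W).val.map hH.eigenvalues ≤ (univ : Finset (V × W)).val.map hP.eigenvalues := by
  obtain ⟨i₀, hi₀⟩ := exists_lapMatrix_eigenvalues_eq_zero G hG
  rw [map_eigenvalues_lapMatrix_boxProd G H hG hH hP]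
  have hemb : (univ : Finset W).val.map hH.eigenvalues =
      ((univ : Finset W).map ⟨fun j => (i₀, j), fun a b h => by simpa using congrArg Prod.snd h⟩).val.map
        (fun p : V × W => hG.eigenvalues p.1 + hH.eigenvalues p.2) := by
    rw [Finset.map_val, Multiset.map_map]
    refine Multiset.map_congr rfl fun j _ => ?_
    simp [hi₀]
  rw [hemb]
  exact Multiset.map_le_map (Finset.val_le_iff.2 (Finset.subset_univ _))

/-! ## §2 Fiedler's product theorem -/

/-- **`a(G □ H) ≤ a(G)`** (`|V|, |W| ≥ 2`): `a(G) = a(G) + 0` is a Laplace eigenvalue of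
`G □ H` outside the bottom zero. [cite: Fiedler1973, §3 item 3.4 (p. 300)] -/
theorem algConn_boxProd_le_left [DecidableRel (G □ H).Adj] (ht : 2 ≤ Fintype.card V)
    (hr : 2 ≤ Fintype.card W) (hG : (G.lapMatrix ℝ).IsHermitian)
    (hH : (H.lapMatrix ℝ).IsHermitian) (hP : ((G □ H).lapMatrix ℝ).IsHermitian) :
    hP.eigenvalues₀ ⟨Fintype.card (V × W) - 2,
      Nat.sub_lt (by rw [Fintype.card_prod]; exact Nat.mul_pos (by omega) (by omega)) two_pos⟩ ≤
      hG.eigenvalues₀ ⟨Fintype.card V - 2, by omega⟩ := by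
  haveI : Nonempty W := Fintype.card_pos_iff.1 (by omega)
  have hPcard : 2 ≤ Fintype.card (V × W) := by
    rw [Fintype.card_prod]; exact le_trans (by norm_num) (Nat.mul_le_mul ht hr)
  obtain ⟨-, hPmin⟩ := algConn_isLeast_erase (G □ H) hPcard hP
  obtain ⟨hGmem, -⟩ := algConn_isLeast_erase G ht hG
  exact hPmin _ (Multiset.mem_of_le
    (Multiset.erase_le_erase _ (map_eigenvalues_le_boxProd_left G H hG hH hP)) hGmem)

/-- **`a(G □ H) ≤ a(H)`** (`|V|, |W| ≥ 2`). [cite: Fiedler1973, §3 item 3.4 (p. 300)] -/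
theorem algConn_boxProd_le_right [DecidableRel (G □ H).Adj] (ht : 2 ≤ Fintype.card V)
    (hr : 2 ≤ Fintype.card W) (hG : (G.lapMatrix ℝ).IsHermitian)
    (hH : (H.lapMatrix ℝ).IsHermitian) (hP : ((G □ H).lapMatrix ℝ).IsHermitian) :
    hP.eigenvalues₀ ⟨Fintype.card (V × W) - 2,
      Nat.sub_lt (by rw [Fintype.card_prod]; exact Nat.mul_pos (by omega) (by omega)) two_pos⟩ ≤
      hH.eigenvalues₀ ⟨Fintype.card W - 2, by omega⟩ := by
  haveI : Nonempty V := Fintype.card_pos_iff.1 (by omega)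
  have hPcard : 2 ≤ Fintype.card (V × W) := by
    rw [Fintype.card_prod]; exact le_trans (by norm_num) (Nat.mul_le_mul ht hr)
  obtain ⟨-, hPmin⟩ := algConn_isLeast_erase (G □ H) hPcard hP
  obtain ⟨hHmem, -⟩ := algConn_isLeast_erase H hr hH
  exact hPmin _ (Multiset.mem_of_le
    (Multiset.erase_le_erase _ (map_eigenvalues_le_boxProd_right G H hG hH hP)) hHmem)

/-- **Fiedler 1973, 3.4: `a(G₁ × G₂) = min(a(G₁), a(G₂))`** for the Cartesian product `G □ H` of
graphs on `|V|, |W| ≥ 2` vertices («all eigenvalues of `A(G₁ × G₂)` are of the form `μ + ν` …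
Hence the second smallest eigenvalue of `A(G₁ × G₂)` is either `a(G₁) + 0` or `0 + a(G₂)`»; the
second-smallest sum `λ_i + μ_j` has `λ_i ≠ 0` (then it is `≥ a(G)`), or `μ_j ≠ 0` (`≥ a(H)`), or
is `0 + 0` — a second zero, i.e. `G □ H` disconnected, i.e. `G` or `H` disconnected and
`min = 0`). [cite: Fiedler1973, §3 item 3.4 (p. 300)] [cite: Molitierno2012, §5.1 Exercise 2,
p0154] -/
theorem Fiedler1973_3_4 [DecidableRel (G □ H).Adj] (ht : 2 ≤ Fintype.card V)
    (hr : 2 ≤ Fintype.card W) (hG : (G.lapMatrix ℝ).IsHermitian)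
    (hH : (H.lapMatrix ℝ).IsHermitian) (hP : ((G □ H).lapMatrix ℝ).IsHermitian) :
    hP.eigenvalues₀ ⟨Fintype.card (V × W) - 2,
      Nat.sub_lt (by rw [Fintype.card_prod]; exact Nat.mul_pos (by omega) (by omega)) two_pos⟩ =
      min (hG.eigenvalues₀ ⟨Fintype.card V - 2, by omega⟩)
        (hH.eigenvalues₀ ⟨Fintype.card W - 2, by omega⟩) := by
  haveI : Nonempty V := Fintype.card_pos_iff.1 (by omega)
  haveI : Nonempty W := Fintype.card_pos_iff.1 (by omega)
  have hPcard : 2 ≤ Fintype.card (V × W) := by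
    rw [Fintype.card_prod]; exact le_trans (by norm_num) (Nat.mul_le_mul ht hr)
  refine le_antisymm (le_min (algConn_boxProd_le_left G H ht hr hG hH hP)
    (algConn_boxProd_le_right G H ht hr hG hH hP)) ?_
  -- `a(G □ H) = λ_i + μ_j` for some pair `(i, j)`
  obtain ⟨hPmem, -⟩ := algConn_isLeast_erase (G □ H) hPcard hP
  have hPmem' := Multiset.mem_of_le (Multiset.erase_le _ _) hPmem
  rw [map_eigenvalues_lapMatrix_boxProd G H hG hH hP, Multiset.mem_map] at hPmem'
  obtain ⟨⟨i, j⟩, -, hij⟩ := hPmem'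
  simp only at hij
  have hli : 0 ≤ hG.eigenvalues i := (SimpleGraph.posSemidef_lapMatrix ℝ G).eigenvalues_nonneg i
  have hmj : 0 ≤ hH.eigenvalues j := (SimpleGraph.posSemidef_lapMatrix ℝ H).eigenvalues_nonneg j
  by_cases hi : hG.eigenvalues i = 0
  · by_cases hj : hH.eigenvalues j = 0
    · -- the second-smallest sum is `0 + 0`: `G □ H` is disconnected, so is `G` or `H`
      have hP0 : hP.eigenvalues₀ ⟨Fintype.card (V × W) - 2, by omega⟩ = 0 := by
        rw [← hij, hi, hj, add_zero]
      have hdis : ¬ (G □ H).Connected := fun hc => by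
        have := (algConn_pos_iff_connected (G □ H) hPcard hP).2 hc
        rw [hP0] at this
        exact lt_irrefl _ this
      rw [SimpleGraph.connected_boxProd, not_and_or] at hdis
      rw [hP0]
      rcases hdis with hGd | hHd
      · rw [algConn_eq_zero_of_not_connected G ht hG hGd]
        exact min_le_left _ _
      · rw [algConn_eq_zero_of_not_connected H hr hH hHd]
        exact min_le_right _ _
    · -- `μ_j ≠ 0`: `a(H) ≤ μ_j ≤ λ_i + μ_j`
      obtain ⟨-, hHmin⟩ := algConn_isLeast_erase H hr hH
      have h1 := hHmin _ ((Multiset.mem_erase_of_ne hj).2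
        (Multiset.mem_map.2 ⟨j, Finset.mem_univ _, rfl⟩))
      rw [← hij]
      exact (min_le_right _ _).trans (by linarith)
  · -- `λ_i ≠ 0`: `a(G) ≤ λ_i ≤ λ_i + μ_j`
    obtain ⟨-, hGmin⟩ := algConn_isLeast_erase G ht hG
    have h1 := hGmin _ ((Multiset.mem_erase_of_ne hi).2
      (Multiset.mem_map.2 ⟨i, Finset.mem_univ _, rfl⟩))
    rw [← hij]
    exact (min_le_left _ _).trans (by linarith)

/-- `algConn_boxProd` — the tree-vocabulary name of `Fiedler1973_3_4`:
`a(G □ H) = min(a(G), a(H))`. [cite: Fiedler1973, §3 item 3.4 (p. 300)] -/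
theorem algConn_boxProd [DecidableRel (G □ H).Adj] (ht : 2 ≤ Fintype.card V)
    (hr : 2 ≤ Fintype.card W) (hG : (G.lapMatrix ℝ).IsHermitian)
    (hH : (H.lapMatrix ℝ).IsHermitian) (hP : ((G □ H).lapMatrix ℝ).IsHermitian) :
    hP.eigenvalues₀ ⟨Fintype.card (V × W) - 2,
      Nat.sub_lt (by rw [Fintype.card_prod]; exact Nat.mul_pos (by omega) (by omega)) two_pos⟩ =
      min (hG.eigenvalues₀ ⟨Fintype.card V - 2, by omega⟩)
        (hH.eigenvalues₀ ⟨Fintype.card W - 2, by omega⟩) :=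
  Fiedler1973_3_4 G H ht hr hG hH hP

/-- **`G □ H` is exactly as well connected (algebraically) as its weaker factor**: in
particular `a(G □ H) > 0 ↔ a(G) > 0 ∧ a(H) > 0` (the spectral form of Mathlib's
`SimpleGraph.connected_boxProd`). [cite: Fiedler1973, §3 item 3.4 (p. 300) with §1 («`a(G)` is
zero if and only if the graph `G` is not connected», p. 298)] -/
theorem algConn_boxProd_pos_iff [DecidableRel (G □ H).Adj] (ht : 2 ≤ Fintype.card V)
    (hr : 2 ≤ Fintype.card W) (hG : (G.lapMatrix ℝ).IsHermitian)
    (hH : (H.lapMatrix ℝ).IsHermitian) (hP : ((G □ H).lapMatrix ℝ).IsHermitian) :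
    0 < hP.eigenvalues₀ ⟨Fintype.card (V × W) - 2,
      Nat.sub_lt (by rw [Fintype.card_prod]; exact Nat.mul_pos (by omega) (by omega)) two_pos⟩ ↔
      0 < hG.eigenvalues₀ ⟨Fintype.card V - 2, by omega⟩ ∧
        0 < hH.eigenvalues₀ ⟨Fintype.card W - 2, by omega⟩ := by
  rw [Fiedler1973_3_4 G H ht hr hG hH hP, lt_min_iff]

end Literature.Combinatorics.SimpleGraph.AlgebraicConnectivityCartesianProduct
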